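import Literature.Topology.FourManifolds.SegmentConjPrelim
import Literature.Topology.FourManifolds.SphereInversion
import Mathlib.Analysis.InnerProductSpace.Projection.FiniteDimensional
import HarnessLib

/-!
# End stages of ambient isotopies of `𝕊³` preserve the orientation of the chart

Topic `Literature/Topology/FourManifolds` (trunk T-4MAN). Fact seat
`provefact-Literature.Topology.FourManifolds.Knot.IsConnectedSum.isIsotopic` (Schubert's theorem),
geometric heart for rail knots. For an ambient isotopy `Ψ` of `𝕊³` and a chart point `o` with
`Ψ₁ (ψ⁻¹ o) ≠ N`, the chart derivative `DΦ(o)` of the end stage `Φ = ψ ∘ Ψ₁ ∘ ψ⁻¹`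
(`SegmentConjPrelim.linConj`) has **positive determinant** (`det_linConj_pos`). Proof: the sign of
the chart determinant of `ψ ∘ Ψ_t ∘ ψ⁻¹` at `o` (chart `ψ` from the north pole while
`Ψ_t (ψ⁻¹ o) ≠ N`, the reflected-inverted chart `ρ ∘ ψ ∘ R` while `≠ S`; the transition
`ρ ∘ (inversion)` has positive determinant) is locally constant in `t`, and `+1` at `t = 0`.

This first part: determinants of the inversion and of the transition, the stage conjugates and
their derivatives.

Everything is proved; no named facts are introduced.

## References

* M. W. Hirsch, *Differential Topology*, Springer GTM 33 (1976), Ch. 8 §1. [HirschDT1976]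
-/

open scoped Manifold ContDiff Topology Real
open Function Set Metric Filter

noncomputable section

namespace Literature.Topology.FourManifolds

/-- Local notation: `𝔼 n` is the model Euclidean space `EuclideanSpace ℝ (Fin n)`. -/
local notation "𝔼 " n:arg => EuclideanSpace ℝ (Fin n)

/-- Local notation: `𝕊 n` is the unit sphere in `EuclideanSpace ℝ (Fin (n + 1))`. -/
local notation "𝕊 " n:arg => (Metric.sphere (0 : EuclideanSpace ℝ (Fin (n + 1))) 1)

attribute [local instance] fact_finrank_euclideanSpace_succ

open KnotsInBall

namespace StageOrientationSign

/-! ### Determinants: hyperplane reflections and the inversion -/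

/-- **The reflection in the hyperplane orthogonal to a nonzero vector has determinant `-1`.**
[folklore] -/
theorem det_reflection_orthogonal {v : 𝔼 3} (hv : v ≠ 0) :
    LinearMap.det ((ℝ ∙ v)ᗮ.reflection.toLinearEquiv : (𝔼 3) →ₗ[ℝ] 𝔼 3) = -1 := by
  have h := Submodule.det_reflection (K := (ℝ ∙ v)ᗮ)
  rw [Submodule.orthogonal_orthogonal, finrank_span_singleton hv, pow_one] at h
  exact h

/-- **The derivative of the inversion**: `(2/‖y‖)² •` the hyperplane reflection orthogonal to `y`
(`y ≠ 0`). [folklore] -/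
theorem hasFDerivAt_sphereInv {y : 𝔼 3} (hy : y ≠ 0) :
    HasFDerivAt sphereInv (((2 : ℝ) / ‖y‖) ^ 2 • ((ℝ ∙ y)ᗮ.reflection : (𝔼 3) →L[ℝ] 𝔼 3)) y := by
  have h := EuclideanGeometry.hasFDerivAt_inversion (c := (0 : 𝔼 3)) (R := 2) hy
  rw [sphereInv_eq_inversion]
  simpa [dist_zero_right] using h

/-- **The determinant of the derivative of the inversion is negative.** [folklore] -/
theorem det_fderiv_sphereInv_neg {y : 𝔼 3} (hy : y ≠ 0) :
    LinearMap.det ((fderiv ℝ sphereInv y : (𝔼 3) →L[ℝ] 𝔼 3) : (𝔼 3) →ₗ[ℝ] 𝔼 3) < 0 := by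
  rw [(hasFDerivAt_sphereInv hy).fderiv]
  have hn : 0 < ((2 : ℝ) / ‖y‖) ^ 2 := by have := norm_pos_iff.2 hy; positivity
  rw [ContinuousLinearMap.toLinearMap_smul, LinearMap.det_smul]
  have e : ((((ℝ ∙ y)ᗮ.reflection : (𝔼 3) →L[ℝ] 𝔼 3) : (𝔼 3) →ₗ[ℝ] 𝔼 3)) =
      ((ℝ ∙ y)ᗮ.reflection.toLinearEquiv : (𝔼 3) →ₗ[ℝ] 𝔼 3) := rfl
  rw [show Module.finrank ℝ (𝔼 3) = 3 from finrank_euclideanSpace_fin, e, det_reflection_orthogonal hy]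
  have : 0 < (((2 : ℝ) / ‖y‖) ^ 2) ^ 3 := by positivity
  linarith

/-- **The sign corrector**: the reflection of `ℝ³` in the plane orthogonal to the first basis
vector. [folklore] -/
def rho : (𝔼 3) →L[ℝ] 𝔼 3 := ((ℝ ∙ (EuclideanSpace.single (0 : Fin 3) (1 : ℝ)))ᗮ.reflection : (𝔼 3) →L[ℝ] 𝔼 3)

/-- The sign corrector has determinant `-1`. [folklore] -/
theorem det_rho : LinearMap.det (rho : (𝔼 3) →ₗ[ℝ] 𝔼 3) = -1 := by
  have hv : (EuclideanSpace.single (0 : Fin 3) (1 : ℝ) : 𝔼 3) ≠ 0 := by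
    intro h; have := congrArg (· 0) h; simp at this
  exact det_reflection_orthogonal hv

/-- The sign corrector is smooth (linear). [folklore] -/
theorem contDiff_rho : ContDiff ℝ ∞ rho := rho.contDiff

/-- **The transition `ρ ∘ (inversion)` has positive determinant.** [folklore] -/
theorem det_fderiv_rho_sphereInv_pos {y : 𝔼 3} (hy : y ≠ 0) :
    0 < LinearMap.det ((fderiv ℝ (rho ∘ sphereInv) y : (𝔼 3) →L[ℝ] 𝔼 3) : (𝔼 3) →ₗ[ℝ] 𝔼 3) := by
  have hd : HasFDerivAt (rho ∘ sphereInv) (rho.comp (fderiv ℝ sphereInv y)) y :=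
    rho.hasFDerivAt.comp y (hasFDerivAt_sphereInv hy).differentiableAt.hasFDerivAt
  have e : ((rho.comp (fderiv ℝ sphereInv y) : (𝔼 3) →L[ℝ] 𝔼 3) : (𝔼 3) →ₗ[ℝ] 𝔼 3) =
      (rho : (𝔼 3) →ₗ[ℝ] 𝔼 3).comp (fderiv ℝ sphereInv y : (𝔼 3) →ₗ[ℝ] 𝔼 3) := rfl
  rw [hd.fderiv, e, LinearMap.det_comp, det_rho]
  have := det_fderiv_sphereInv_neg hy
  nlinarith

/-! ### Chart conjugates of a diffeomorphism of the sphere -/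

section Conj

variable (θ : (𝕊 3) ≃ₘ⟮𝓡 3, 𝓡 3⟯ (𝕊 3))

/-- **The chart conjugate** `ψ ∘ θ ∘ ψ⁻¹` of a diffeomorphism. [folklore] -/
def dconj (y : 𝔼 3) : 𝔼 3 := psiN (θ (psiN.symm y))

/-- Smoothness of the chart conjugate where `θ (ψ⁻¹ y) ≠ N`. [folklore] -/
theorem contDiffAt_dconj {y : 𝔼 3} (hy : θ (psiN.symm y) ≠ northPole) : ContDiffAt ℝ ∞ (dconj θ) y := by
  have h1 : ContMDiffAt 𝓘(ℝ, 𝔼 3) (𝓡 3) ∞ psiN.symm y := contMDiff_psiN_symm y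
  have h2 : ContMDiffAt (𝓡 3) (𝓡 3) ∞ θ (psiN.symm y) := (θ.contMDiff) _
  have h3 : ContMDiffAt (𝓡 3) 𝓘(ℝ, 𝔼 3) ∞ psiN (θ (psiN.symm y)) := isFullChart_psiN.contMDiffAt (mem_psiN_source hy)
  exact contMDiffAt_iff_contDiffAt.1 (h3.comp y (h2.comp y h1))

/-- The non-pole condition is open. [folklore] -/
theorem isOpen_setOf_dconj_ne : IsOpen {y : 𝔼 3 | θ (psiN.symm y) ≠ northPole} :=
  isOpen_ne.preimage (θ.continuous.comp contMDiff_psiN_symm.continuous)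

/-- `(ψ θ⁻¹ ψ⁻¹) (ψ θ ψ⁻¹ y) = y` where `θ (ψ⁻¹ y) ≠ N`. [folklore] -/
theorem dconj_symm_dconj {y : 𝔼 3} (hy : θ (psiN.symm y) ≠ northPole) : dconj θ.symm (dconj θ y) = y := by
  rw [dconj, dconj, psiN_symm_apply_psiN hy, Diffeomorph.symm_apply_apply, psiN_apply_psiN_symm]

/-- At the image point the inverse condition holds. [folklore] -/
theorem symm_dconj_ne {y : 𝔼 3} (hy : θ (psiN.symm y) ≠ northPole) : θ.symm (psiN.symm (dconj θ y)) ≠ northPole := by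
  rw [dconj, psiN_symm_apply_psiN hy, Diffeomorph.symm_apply_apply]; exact psiN_symm_ne_northPole _

/-- `(ψ θ⁻¹ ψ⁻¹) ∘ (ψ θ ψ⁻¹) = id` near a good point. [folklore] -/
theorem dconj_symm_comp_eventuallyEq {y : 𝔼 3} (hy : θ (psiN.symm y) ≠ northPole) :
    dconj θ.symm ∘ dconj θ =ᶠ[𝓝 y] id := by
  filter_upwards [(isOpen_setOf_dconj_ne θ).mem_nhds hy] with y' hy'
  exact dconj_symm_dconj θ hy'

/-- **The derivative of the chart conjugate is invertible** at a good point. [folklore] -/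
def linD {y : 𝔼 3} (hy : θ (psiN.symm y) ≠ northPole) : (𝔼 3) ≃L[ℝ] 𝔼 3 := by
  refine ContinuousLinearEquiv.equivOfInverse (fderiv ℝ (dconj θ) y) (fderiv ℝ (dconj θ.symm) (dconj θ y))
    (fun v ↦ ?_) (fun v ↦ ?_)
  · have hΦ := (contDiffAt_dconj θ hy).differentiableAt (by simp)
    have hΦ' := (contDiffAt_dconj θ.symm (symm_dconj_ne θ hy)).differentiableAt (by simp)
    have hc := hΦ'.hasFDerivAt.comp y hΦ.hasFDerivAt
    have hid : HasFDerivAt (dconj θ.symm ∘ dconj θ) (ContinuousLinearMap.id ℝ (𝔼 3)) y :=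
      (hasFDerivAt_id y).congr_of_eventuallyEq (dconj_symm_comp_eventuallyEq θ hy)
    exact congrArg (fun f : (𝔼 3) →L[ℝ] 𝔼 3 ↦ f v) (hc.unique hid)
  · have hy2 := symm_dconj_ne θ hy
    have hΦ' := (contDiffAt_dconj θ.symm hy2).differentiableAt (by simp)
    have hy' : dconj θ.symm (dconj θ y) = y := dconj_symm_dconj θ hy
    have hΦ : DifferentiableAt ℝ (dconj θ) (dconj θ.symm (dconj θ y)) := by
      rw [hy']; exact (contDiffAt_dconj θ hy).differentiableAt (by simp)
    have hc := hΦ.hasFDerivAt.comp _ hΦ'.hasFDerivAt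
    have hid : HasFDerivAt (dconj θ ∘ dconj θ.symm) (ContinuousLinearMap.id ℝ (𝔼 3)) (dconj θ y) :=
      (hasFDerivAt_id _).congr_of_eventuallyEq (dconj_symm_comp_eventuallyEq θ.symm hy2)
    have := hc.unique hid
    rw [hy'] at this
    exact congrArg (fun f : (𝔼 3) →L[ℝ] 𝔼 3 ↦ f v) this

/-- **The chart determinant of a diffeomorphism at a good point is nonzero.** [folklore] -/
theorem det_fderiv_dconj_ne_zero {y : 𝔼 3} (hy : θ (psiN.symm y) ≠ northPole) :
    LinearMap.det ((fderiv ℝ (dconj θ) y : (𝔼 3) →L[ℝ] 𝔼 3) : (𝔼 3) →ₗ[ℝ] 𝔼 3) ≠ 0 := by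
  have e : ((fderiv ℝ (dconj θ) y : (𝔼 3) →L[ℝ] 𝔼 3) : (𝔼 3) →ₗ[ℝ] 𝔼 3) =
      ((linD θ hy : (𝔼 3) ≃L[ℝ] 𝔼 3).toLinearEquiv : (𝔼 3) →ₗ[ℝ] 𝔼 3) := rfl
  rw [e, ← LinearEquiv.coe_det]
  exact Units.ne_zero _

end Conj

/-! ### Families: smoothness in `(t, y)` and continuity of the chart derivative in `t` -/

/-- **A jointly smooth family on the sphere read in the chart is jointly smooth** at `(t₀, o)` when
`Θ t₀ (ψ⁻¹ o) ≠ N`. [folklore] -/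
theorem contDiffAt_conjFamily {Θ : ℝ → (𝕊 3) → (𝕊 3)} (hΘ : ContMDiff (𝓘(ℝ, ℝ).prod (𝓡 3)) (𝓡 3) ∞ (uncurry Θ))
    {t₀ : ℝ} {o : 𝔼 3} (h : Θ t₀ (psiN.symm o) ≠ northPole) :
    ContDiffAt ℝ ∞ (fun p : ℝ × 𝔼 3 ↦ psiN (Θ p.1 (psiN.symm p.2))) (t₀, o) := by
  have h1 : ContMDiffAt (𝓘(ℝ, ℝ).prod 𝓘(ℝ, 𝔼 3)) (𝓘(ℝ, ℝ).prod (𝓡 3)) ∞ (fun p : ℝ × 𝔼 3 ↦ (p.1, psiN.symm p.2)) (t₀, o) :=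
    contMDiffAt_fst.prodMk ((contMDiff_psiN_symm _).comp (t₀, o) contMDiffAt_snd)
  have h2 : ContMDiffAt (𝓘(ℝ, ℝ).prod (𝓡 3)) (𝓡 3) ∞ (uncurry Θ) (t₀, psiN.symm o) := hΘ _
  have h3 : ContMDiffAt (𝓡 3) 𝓘(ℝ, 𝔼 3) ∞ psiN (Θ t₀ (psiN.symm o)) := isFullChart_psiN.contMDiffAt (mem_psiN_source h)
  have h4 : ContMDiffAt (𝓘(ℝ, ℝ).prod 𝓘(ℝ, 𝔼 3)) 𝓘(ℝ, 𝔼 3) ∞ (fun p : ℝ × 𝔼 3 ↦ psiN (Θ p.1 (psiN.symm p.2))) (t₀, o) :=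
    h3.comp (t₀, o) (h2.comp (t₀, o) h1)
  rw [← modelWithCornersSelf_prod, chartedSpaceSelf_prod] at h4
  exact contMDiffAt_iff_contDiffAt.1 h4

/-- **Continuity in `t` of the chart derivative of a jointly smooth family.** [folklore] -/
theorem continuousAt_fderiv_conjFamily {Θ : ℝ → (𝕊 3) → (𝕊 3)} (hΘ : ContMDiff (𝓘(ℝ, ℝ).prod (𝓡 3)) (𝓡 3) ∞ (uncurry Θ))
    {t₀ : ℝ} {o : 𝔼 3} (h : Θ t₀ (psiN.symm o) ≠ northPole) :
    ContinuousAt (fun t ↦ fderiv ℝ (fun y ↦ psiN (Θ t (psiN.symm y))) o) t₀ := by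
  set J : ℝ × 𝔼 3 → 𝔼 3 := fun p ↦ psiN (Θ p.1 (psiN.symm p.2)) with hJ
  -- the good times are open
  have hcont : Continuous fun t ↦ Θ t (psiN.symm o) :=
    hΘ.continuous.comp (continuous_id.prodMk continuous_const)
  have hopen : ∀ᶠ t in 𝓝 t₀, Θ t (psiN.symm o) ≠ northPole := hcont.continuousAt.eventually_ne h
  -- `fderiv (J (t, ·)) o = (fderiv J (t, o)) ∘ inr` at good times
  have hform : ∀ t, Θ t (psiN.symm o) ≠ northPole → fderiv ℝ (fun y ↦ psiN (Θ t (psiN.symm y))) o =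
      (fderiv ℝ J (t, o)).comp (ContinuousLinearMap.inr ℝ ℝ (𝔼 3)) := fun t ht ↦ by
    have hJt : DifferentiableAt ℝ J (t, o) := (contDiffAt_conjFamily hΘ ht).differentiableAt (by simp)
    have hi : HasFDerivAt (fun y : 𝔼 3 ↦ ((t, y) : ℝ × 𝔼 3)) (ContinuousLinearMap.inr ℝ ℝ (𝔼 3)) o :=
      (hasFDerivAt_const t o).prodMk (hasFDerivAt_id o)
    exact (hJt.hasFDerivAt.comp o hi).fderiv
  -- continuity of `p ↦ fderiv J p` at `(t₀, o)`
  have hcd : ContinuousAt (fderiv ℝ J) (t₀, o) := (contDiffAt_conjFamily hΘ h).continuousAt_fderiv (by simp)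
  have hc2 : ContinuousAt (fun t ↦ fderiv ℝ J (t, o)) t₀ :=
    hcd.comp (f := fun t : ℝ ↦ ((t, o) : ℝ × 𝔼 3)) (continuous_id.prodMk continuous_const).continuousAt
  have hc3 : ContinuousAt (fun t ↦ (fderiv ℝ J (t, o)).comp (ContinuousLinearMap.inr ℝ ℝ (𝔼 3))) t₀ :=
    ((ContinuousLinearMap.compL ℝ (𝔼 3) (ℝ × 𝔼 3) (𝔼 3)).flip (ContinuousLinearMap.inr ℝ ℝ (𝔼 3))).continuous.continuousAt.comp hc2
  refine hc3.congr ?_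
  filter_upwards [hopen] with t ht using (hform t ht).symm

/-! ### The two chart determinants of the stages of an ambient isotopy -/

section Stages

variable (Ψ : AmbientIsotopy (𝓡 3) (𝕊 3)) (o : 𝔼 3)

/-- The stage read in the north chart: `ψ ∘ Ψ_t ∘ ψ⁻¹ = dconj (Ψ.toDiffeomorph t)`. [folklore] -/
theorem dconj_stage (t : ℝ) (y : 𝔼 3) : dconj (Ψ.toDiffeomorph t) y = psiN (Ψ.toFun t (psiN.symm y)) := rfl

/-- **The north determinant** `det D(ψ Ψ_t ψ⁻¹)(o)`. [folklore] -/
def gN (t : ℝ) : ℝ := LinearMap.det ((fderiv ℝ (dconj (Ψ.toDiffeomorph t)) o : (𝔼 3) →L[ℝ] 𝔼 3) : (𝔼 3) →ₗ[ℝ] 𝔼 3)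

/-- The reflected stage `R ∘ Ψ_t`, a diffeomorphism. [folklore] -/
def stageS (t : ℝ) : (𝕊 3) ≃ₘ⟮𝓡 3, 𝓡 3⟯ (𝕊 3) := (Ψ.toDiffeomorph t).trans (reflectLastDiffeo 3)

/-- The reflected stage as a function. [folklore] -/
theorem stageS_apply (t : ℝ) (x : 𝕊 3) : stageS Ψ t x = reflectLast 3 (Ψ.toFun t x) := rfl

/-- **The south determinant** `det D(ρ ψ R Ψ_t ψ⁻¹)(o)`. [folklore] -/
def gS (t : ℝ) : ℝ := LinearMap.det ((fderiv ℝ (rho ∘ dconj (stageS Ψ t)) o : (𝔼 3) →L[ℝ] 𝔼 3) : (𝔼 3) →ₗ[ℝ] 𝔼 3)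

/-- The north determinant does not vanish at north-good times. [folklore] -/
theorem gN_ne_zero {t : ℝ} (ht : Ψ.toFun t (psiN.symm o) ≠ northPole) : gN Ψ o t ≠ 0 :=
  det_fderiv_dconj_ne_zero (Ψ.toDiffeomorph t) ht

/-- The south determinant does not vanish at south-good times. [folklore] -/
theorem gS_ne_zero {t : ℝ} (ht : Ψ.toFun t (psiN.symm o) ≠ southPole) : gS Ψ o t ≠ 0 := by
  have ht' : stageS Ψ t (psiN.symm o) ≠ northPole := fun h ↦ ht ((reflectLast_eq_northPole_iff _).1 h)
  have hd : HasFDerivAt (rho ∘ dconj (stageS Ψ t)) (rho.comp (fderiv ℝ (dconj (stageS Ψ t)) o)) o :=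
    rho.hasFDerivAt.comp o ((contDiffAt_dconj _ ht').differentiableAt (by simp)).hasFDerivAt
  have e : ((rho.comp (fderiv ℝ (dconj (stageS Ψ t)) o) : (𝔼 3) →L[ℝ] 𝔼 3) : (𝔼 3) →ₗ[ℝ] 𝔼 3) =
      (rho : (𝔼 3) →ₗ[ℝ] 𝔼 3).comp (fderiv ℝ (dconj (stageS Ψ t)) o : (𝔼 3) →ₗ[ℝ] 𝔼 3) := rfl
  rw [gS, hd.fderiv, e, LinearMap.det_comp, det_rho]
  have := det_fderiv_dconj_ne_zero (stageS Ψ t) ht'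
  simpa using this

/-- **On the overlap the two determinants have the same sign**: at times where `Ψ_t (ψ⁻¹ o)` is
neither pole, `gS = det D(ρ ∘ inversion) · gN` with a positive factor. [folklore] -/
theorem gS_eq_mul_gN {t : ℝ} (hN : Ψ.toFun t (psiN.symm o) ≠ northPole) (hS : Ψ.toFun t (psiN.symm o) ≠ southPole) :
    gS Ψ o t = LinearMap.det ((fderiv ℝ (rho ∘ sphereInv) (dconj (Ψ.toDiffeomorph t) o) : (𝔼 3) →L[ℝ] 𝔼 3) : (𝔼 3) →ₗ[ℝ] 𝔼 3) *
      gN Ψ o t := by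
  -- near `o` both pole conditions hold and `ρ ψ R Ψ_t ψ⁻¹ = (ρ ∘ inversion) ∘ (ψ Ψ_t ψ⁻¹)`
  have hc : Continuous fun y ↦ Ψ.toFun t (psiN.symm y) := (Ψ.contMDiff_toFun t).continuous.comp contMDiff_psiN_symm.continuous
  have hev : rho ∘ dconj (stageS Ψ t) =ᶠ[𝓝 o] (rho ∘ sphereInv) ∘ dconj (Ψ.toDiffeomorph t) := by
    filter_upwards [hc.continuousAt.eventually_ne hN, hc.continuousAt.eventually_ne hS] with y h1 h2
    have h2' : reflectLast 3 (Ψ.toFun t (psiN.symm y)) ≠ northPole := fun h ↦ h2 ((reflectLast_eq_northPole_iff _).1 h)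
    simp only [comp_apply, dconj, stageS_apply, AmbientIsotopy.coe_toDiffeomorph]
    rw [psiN_reflectLast h1 h2']
  have hz : dconj (Ψ.toDiffeomorph t) o ≠ 0 := psiN_ne_zero hN hS
  have hd1 := ((contDiffAt_dconj (Ψ.toDiffeomorph t) hN).differentiableAt (by simp)).hasFDerivAt
  have hd2 : HasFDerivAt (rho ∘ sphereInv) (fderiv ℝ (rho ∘ sphereInv) (dconj (Ψ.toDiffeomorph t) o)) (dconj (Ψ.toDiffeomorph t) o) :=
    (rho.hasFDerivAt.comp _ (hasFDerivAt_sphereInv hz)).differentiableAt.hasFDerivAt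
  have hd := (hd2.comp o hd1).congr_of_eventuallyEq hev
  have e : (((fderiv ℝ (rho ∘ sphereInv) (dconj (Ψ.toDiffeomorph t) o)).comp (fderiv ℝ (dconj (Ψ.toDiffeomorph t)) o) :
      (𝔼 3) →L[ℝ] 𝔼 3) : (𝔼 3) →ₗ[ℝ] 𝔼 3) =
      (fderiv ℝ (rho ∘ sphereInv) (dconj (Ψ.toDiffeomorph t) o) : (𝔼 3) →ₗ[ℝ] 𝔼 3).comp
        (fderiv ℝ (dconj (Ψ.toDiffeomorph t)) o : (𝔼 3) →ₗ[ℝ] 𝔼 3) := rfl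
  rw [gS, hd.fderiv, e, LinearMap.det_comp, gN]

/-- The north determinant is continuous at north-good times. [folklore] -/
theorem continuousAt_gN {t₀ : ℝ} (ht : Ψ.toFun t₀ (psiN.symm o) ≠ northPole) : ContinuousAt (gN Ψ o) t₀ := by
  have h := continuousAt_fderiv_conjFamily Ψ.contMDiff ht
  exact (ContinuousLinearMap.continuous_det.continuousAt).comp h

/-- The reflected family is jointly smooth. [folklore] -/
theorem contMDiff_reflect_family : ContMDiff (𝓘(ℝ, ℝ).prod (𝓡 3)) (𝓡 3) ∞ (uncurry fun t x ↦ reflectLast 3 (Ψ.toFun t x)) :=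
  (reflectLastDiffeo 3).contMDiff.comp Ψ.contMDiff

/-- The south determinant is continuous at south-good times. [folklore] -/
theorem continuousAt_gS {t₀ : ℝ} (ht : Ψ.toFun t₀ (psiN.symm o) ≠ southPole) : ContinuousAt (gS Ψ o) t₀ := by
  have ht' : reflectLast 3 (Ψ.toFun t₀ (psiN.symm o)) ≠ northPole := fun h ↦ ht ((reflectLast_eq_northPole_iff _).1 h)
  have h := continuousAt_fderiv_conjFamily (contMDiff_reflect_family Ψ) ht'
  -- `fderiv (ρ ∘ F_t) o = ρ ∘L fderiv F_t o` at south-good times (eventually)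
  have hc : Continuous fun t ↦ Ψ.toFun t (psiN.symm o) := Ψ.contMDiff.continuous.comp (continuous_id.prodMk continuous_const)
  have hev : ∀ᶠ t in 𝓝 t₀, gS Ψ o t =
      LinearMap.det ((rho.comp (fderiv ℝ (fun y ↦ psiN (reflectLast 3 (Ψ.toFun t (psiN.symm y)))) o) : (𝔼 3) →L[ℝ] 𝔼 3) :
        (𝔼 3) →ₗ[ℝ] 𝔼 3) := by
    filter_upwards [hc.continuousAt.eventually_ne ht] with t ht2
    have ht2' : stageS Ψ t (psiN.symm o) ≠ northPole := fun h ↦ ht2 ((reflectLast_eq_northPole_iff _).1 h)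
    have hd : HasFDerivAt (rho ∘ dconj (stageS Ψ t)) (rho.comp (fderiv ℝ (dconj (stageS Ψ t)) o)) o :=
      rho.hasFDerivAt.comp o ((contDiffAt_dconj _ ht2').differentiableAt (by simp)).hasFDerivAt
    rw [gS, hd.fderiv]; rfl
  have h2 : ContinuousAt (fun t ↦ LinearMap.det ((rho.comp (fderiv ℝ (fun y ↦ psiN (reflectLast 3 (Ψ.toFun t (psiN.symm y)))) o) :
      (𝔼 3) →L[ℝ] 𝔼 3) : (𝔼 3) →ₗ[ℝ] 𝔼 3)) t₀ :=
    (ContinuousLinearMap.continuous_det.continuousAt).comp (((ContinuousLinearMap.compL ℝ (𝔼 3) (𝔼 3) (𝔼 3)) rho).continuous.continuousAt.comp h)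
  exact h2.congr (hev.mono fun t ht ↦ ht.symm)

/-- At time `0` the north determinant is `1`. [folklore] -/
theorem gN_zero : gN Ψ o 0 = 1 := by
  have e : dconj (Ψ.toDiffeomorph 0) = id := by
    funext y; rw [dconj_stage, Ψ.map_zero]; exact psiN_apply_psiN_symm y
  rw [gN, e, fderiv_id]
  simp

/-- **THE SIGN IS CONSTANT**: at every time in `[0, 1]` the applicable determinant is positive.
[folklore] -/
theorem pos_of_mem (ho : psiN.symm o ≠ northPole) {t : ℝ} (ht : t ∈ Icc (0 : ℝ) 1) :
    (Ψ.toFun t (psiN.symm o) ≠ northPole ∧ 0 < gN Ψ o t) ∨ (Ψ.toFun t (psiN.symm o) ≠ southPole ∧ 0 < gS Ψ o t) := by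
  set Pos : Set ℝ := {t | (Ψ.toFun t (psiN.symm o) ≠ northPole ∧ 0 < gN Ψ o t) ∨ (Ψ.toFun t (psiN.symm o) ≠ southPole ∧ 0 < gS Ψ o t)}
  set Neg : Set ℝ := {t | (Ψ.toFun t (psiN.symm o) ≠ northPole ∧ gN Ψ o t < 0) ∨ (Ψ.toFun t (psiN.symm o) ≠ southPole ∧ gS Ψ o t < 0)}
  have hc : Continuous fun t ↦ Ψ.toFun t (psiN.symm o) := Ψ.contMDiff.continuous.comp (continuous_id.prodMk continuous_const)
  have hNS : (northPole : 𝕊 3) ≠ southPole := fun h ↦ by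
    have := congrArg (fun x : 𝕊 3 ↦ (x : 𝔼 4) (Fin.last 3)) h
    simp [northPole, southPole] at this
    norm_num at this
  -- positivity of the overlap factor
  have hfac : ∀ t, Ψ.toFun t (psiN.symm o) ≠ northPole → Ψ.toFun t (psiN.symm o) ≠ southPole →
      0 < LinearMap.det ((fderiv ℝ (rho ∘ sphereInv) (dconj (Ψ.toDiffeomorph t) o) : (𝔼 3) →L[ℝ] 𝔼 3) : (𝔼 3) →ₗ[ℝ] 𝔼 3) :=
    fun t h1 h2 ↦ det_fderiv_rho_sphereInv_pos (psiN_ne_zero h1 h2)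
  -- `Pos` is open
  have hPos : IsOpen Pos := by
    rw [isOpen_iff_mem_nhds]
    rintro t (⟨h1, h2⟩ | ⟨h1, h2⟩)
    · have e1 := hc.continuousAt.eventually_ne h1
      have e2 := (continuousAt_gN Ψ o h1).eventually (Ioi_mem_nhds h2)
      filter_upwards [e1, e2] with r hr1 hr2 using Or.inl ⟨hr1, hr2⟩
    · have e1 := hc.continuousAt.eventually_ne h1
      have e2 := (continuousAt_gS Ψ o h1).eventually (Ioi_mem_nhds h2)
      filter_upwards [e1, e2] with r hr1 hr2 using Or.inr ⟨hr1, hr2⟩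
  have hNeg : IsOpen Neg := by
    rw [isOpen_iff_mem_nhds]
    rintro t (⟨h1, h2⟩ | ⟨h1, h2⟩)
    · have e1 := hc.continuousAt.eventually_ne h1
      have e2 := (continuousAt_gN Ψ o h1).eventually (Iio_mem_nhds h2)
      filter_upwards [e1, e2] with r hr1 hr2 using Or.inl ⟨hr1, hr2⟩
    · have e1 := hc.continuousAt.eventually_ne h1
      have e2 := (continuousAt_gS Ψ o h1).eventually (Iio_mem_nhds h2)
      filter_upwards [e1, e2] with r hr1 hr2 using Or.inr ⟨hr1, hr2⟩
  -- they cover and are disjoint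
  have hcover : (univ : Set ℝ) ⊆ Pos ∪ Neg := by
    intro t _
    by_cases hN : Ψ.toFun t (psiN.symm o) = northPole
    · have hS : Ψ.toFun t (psiN.symm o) ≠ southPole := by rw [hN]; exact hNS
      rcases (gS_ne_zero Ψ o hS).lt_or_gt with h | h
      · exact Or.inr (Or.inr ⟨hS, h⟩)
      · exact Or.inl (Or.inr ⟨hS, h⟩)
    · rcases (gN_ne_zero Ψ o hN).lt_or_gt with h | h
      · exact Or.inr (Or.inl ⟨hN, h⟩)
      · exact Or.inl (Or.inl ⟨hN, h⟩)
  have hdisj : Disjoint Pos Neg := by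
    rw [Set.disjoint_left]
    rintro t (⟨p1, p2⟩ | ⟨p1, p2⟩) (⟨n1, n2⟩ | ⟨n1, n2⟩)
    · linarith
    · have := gS_eq_mul_gN Ψ o p1 n1; have := hfac t p1 n1; nlinarith
    · have := gS_eq_mul_gN Ψ o n1 p1; have := hfac t n1 p1; nlinarith
    · linarith
  have h0 : (0 : ℝ) ∈ Pos := by
    refine Or.inl ⟨by rw [Ψ.map_zero]; exact ho, ?_⟩
    rw [gN_zero]; exact one_pos
  have hsub : Icc (0 : ℝ) 1 ⊆ Pos :=
    isPreconnected_Icc.subset_left_of_subset_union hPos hNeg hdisj (fun r _ ↦ hcover (mem_univ r)) ⟨0, ⟨le_rfl, zero_le_one⟩, h0⟩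
  exact hsub ht

/-- **THE END STAGE OF AN AMBIENT ISOTOPY PRESERVES THE CHART ORIENTATION**: the chart derivative
`DΦ(o)` of `Φ = ψ ∘ Ψ₁ ∘ ψ⁻¹` (`linConj`) has positive determinant. [folklore] -/
theorem det_linConj_pos {o : 𝔼 3} (hy : SegmentConj.stageOne Ψ (psiN.symm o) ≠ northPole) :
    0 < LinearMap.det (((SegmentConj.linConj Ψ hy : (𝔼 3) ≃L[ℝ] 𝔼 3) : (𝔼 3) →L[ℝ] 𝔼 3) : (𝔼 3) →ₗ[ℝ] 𝔼 3) := by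
  have ho : psiN.symm o ≠ northPole := psiN_symm_ne_northPole o
  have hN : Ψ.toFun 1 (psiN.symm o) ≠ northPole := hy
  have h := pos_of_mem Ψ o ho (t := 1) ⟨zero_le_one, le_rfl⟩
  have hgN : 0 < gN Ψ o 1 := by
    rcases h with ⟨-, h⟩ | ⟨hS, h⟩
    · exact h
    · rw [gS_eq_mul_gN Ψ o hN hS] at h
      have := det_fderiv_rho_sphereInv_pos (psiN_ne_zero hN hS)
      exact pos_of_mul_pos_right h this.le |> fun h' ↦ (pos_iff_pos_of_mul_pos h).1 this
  exact hgN

end Stages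

end StageOrientationSign

end Literature.Topology.FourManifolds
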